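/-
Copyright (c) 2026 the pub-hodgecm-mathlib formalisation cell (harness21).  Prover seat hodgecm-mathlib-LH4-p13 (g2), req620 Track A «(D-RAM) FOUR-FRAME» squad
(heir LEAD F0P3a-plan lineage; dealer LH4-plan lineage; MS ROAD A, Stage B «§P» of SPEC `F0/P3c/LH4/LH4-p10/g2/SPEC-StageB.v1.LH4p10g2.md` (B5 §0) and MS LEDGER v4:
the coordinate-permutation transport of strata).  2026-09-04.
-/
import Summits.HodgeConjecture.HodgeConjecture.Theorems.F0P3cDyRamDiagonalStrataDefs   -- ★ DEFS LEAF p855793 (LH4-p10): `HasAxis`, `stratum`; brings ★ TorusDefs (`normalisedStableLattices`, `stabiliserWeight`, …)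
import Literature.NumberTheory.Automorphic.UnitaryLatticeTreeApartment                -- ★ `mem_mapGL_iff`
import Literature.NumberTheory.Automorphic.UnitaryLatticeTreeCentralRescalingCountTransport  -- ★ `mapGL_eq_of_coe_eq_smul` (a unit homothety fixes every lattice)
import Literature.NumberTheory.Automorphic.UnitaryThreeFourFrameDefs                  -- ★ `IsElementDatum` (the binders of B10's sockets)
import Mathlib.LinearAlgebra.Matrix.Permutation                                       -- `Equiv.Perm.permMatrix`, `Matrix.det_permutation`, `Matrix.permMatrix_mulVec`, `Matrix.transpose_permMatrix`
import HarnessLib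

/-!
# Crux `H413`, MS ROAD A, STAGE B «§P»: COORDINATE PERMUTATIONS TRANSPORT THE STRATA — `∑ᶠ_{M ∈ stratum(T, a)} w(M) = ∑ᶠ_{M ∈ stratum(P⁻¹TP, a∘π⁻¹)} w(M)`

Cell `hodgecm-mathlib` (D-0151), FLOOR 0, crux item H413 = `stmt-HodgeConjecture-24833`, route of record `HCCMUnconditional`; squad F0∕P3c∕LH4 (req618∕req620).  THEOREMS ONLY
(no `def`, no instance, no notation, no `sorry`, default heartbeats); lane `--supports stmt-HodgeConjecture-24833 --as helper` (count-neutral).  Road target: tree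
`Cruxes/H413/Lines/F0_P3c_DyRamFourFrame_U3_Laws.lean` stub `stub_U3_stableModelSum` (MS) via B10 (LH4-p10 (g2)); B10's skeleton v1 c61f53438acbd4dd asks for the strata with
FOOT ON `B₂`∕`B₃` (`stub_P_T2∕T3∕G2∕G3`) «by §P» from the `B₁`-footed ones: this file IS §P — a permutation `π` of the coordinates, acting by its permutation matrix `P`
(`P·x = x ∘ π`), carries the stratum of axis vector `a ∘ π⁻¹` for the permuted torus element `P⁻¹TP = diag(d ∘ π⁻¹)` bijectively onto the stratum of axis vector `a` for
`T = diag(d)`, preserving the weight `1∕[𝒰 : S_F(M)]`; so every per-stratum count transports VERBATIM (MEMO v2 §4 (G): «permute coordinates»).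

WHAT IS PROVED (generic `N`, generic valued field `K`, any ring endomorphism `σ`; `π : Equiv.Perm (Fin N)`, `P : GL_N(K)` with matrix `π.permMatrix K`).
* §1 matrices: `P⁻¹` is the matrix of `π⁻¹`; `σ(P) = P`; `P⁻¹·diag(d)·P = diag(d ∘ π⁻¹) = (σP)ᵀ·diag(d)·P`; membership `x ∈ P·M ↔ x ∘ π⁻¹ ∈ M`; `(t·eᵢ) ∘ π⁻¹ = t·e_{π i}`.
* §2 transports: `HasAxis ϖ (P·M) a ↔ HasAxis ϖ M (a ∘ π⁻¹)`; `IsNormalisedLattice (P·M) ↔ IsNormalisedLattice M`; `P·M ∈ 𝓛₀(T) ↔ M ∈ 𝓛₀(P⁻¹TP)`;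
  `IsDualisableLattice σ ϖ (P·M) ↔ IsDualisableLattice σ ϖ M` (★ `isVertexLattice_formCongr_iff`, the dualising form re-indexed); `latticeStabilizer (P·M)` is the preimage of
  `latticeStabilizer M` under `u ↦ u ∘ π⁻¹`, which maps `𝒰` onto `𝒰`, hence **`stabiliserWeight σ (P·M) = stabiliserWeight σ M`** (Mathlib `Subgroup.relIndex_comap`).
* §3 HEADS: `image_mapGL_stratum` — `P · stratum(P⁻¹TP, a ∘ π⁻¹) = stratum(T, a)`; **`finsum_stabiliserWeight_stratum_perm`** — the weighted counts agree; and the UNIT RESCALING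
  `normalisedStableLattices_eq_of_coe_eq_smul` (`𝓛₀(sT) = 𝓛₀(T)` for a unit scalar `s`, ★ `mapGL_eq_of_coe_eq_smul`), needed to bring `diag(1, β, α)` back to B10's shape `diag(·,·,1)`.
HONEST LABEL.  Count-neutral (`--supports`); nothing printed is asserted; (MS) and the census laws stay PROVER TARGETS until the Stage B bricks and B10 land; `HC_CM` is proved only
modulo the 7 printed citations (2 remaining named inputs: hLiu418 = `stmt-HodgeConjecture-24832`, h413 = `stmt-HodgeConjecture-24833`) until rung 0 closes.

## References
* [Kottwitz1986BaseChangeUnits] R. E. Kottwitz, *Base change for unit elements of Hecke algebras*, Compositio Math. 60 (1986), §1 pp. 240–241 (orbital integrals of units as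
  lattice counts modulo the torus; symmetry in the coordinates of the split torus).
* [Rogawski1990] J. D. Rogawski, *Automorphic Representations of Unitary Groups in Three Variables*, Ann. of Math. Stud. 123 (1990), §4.9 Prop. 4.9.1 (a) p. 55.
* [Serre1980Trees] J.-P. Serre, *Trees*, Springer (1980), Ch. II §1.1 (lattices and the monomial action).
-/

set_option autoImplicit false

noncomputable section

namespace Summit.HodgeConjecture.HodgeConjecture.Cruxes.H413.F0P3cDyRamDiagonalPermutation

open Matrix
open Literature.NumberTheory.Automorphic Literature.NumberTheory.Automorphic.HermitianLattice
open Literature.NumberTheory.Automorphic.UnitaryLatticeTree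
open Summit.HodgeConjecture.HodgeConjecture.Cruxes.H413.F0P3cDyRamDiagonalTorusDefs
open Summit.HodgeConjecture.HodgeConjecture.Cruxes.H413.F0P3cDyRamDiagonalStrataDefs
open scoped Valued WithZero Matrix MatrixGroups

variable {K : Type*} [Field K] {N : ℕ}

/-! ## §1  Permutation matrices: inverse, `σ`-invariance, conjugation of diagonals, action on vectors -/

/-- `π⁻¹.P · π.P = 1` (Mathlib's `permMatrix` is contravariant). [cite: Serre1980Trees, II §1.1] -/
theorem permMatrix_inv_mul (π : Equiv.Perm (Fin N)) : (π⁻¹).permMatrix K * π.permMatrix K = 1 := by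
  rw [← Matrix.permMatrix_mul, mul_inv_cancel, Matrix.permMatrix_one]

/-- A permutation matrix has non-zero determinant (`= sign π`). [cite: Serre1980Trees, II §1.1] -/
theorem det_permMatrix_ne_zero (π : Equiv.Perm (Fin N)) : (π.permMatrix K).det ≠ 0 := by
  rw [Matrix.det_permutation]
  rcases Int.units_eq_one_or (Equiv.Perm.sign π) with h | h <;> simp [h]

/-- A `GL_N` element with the permutation matrix of `π`. [cite: Serre1980Trees, II §1.1] -/
theorem exists_gl_coe_eq_permMatrix (π : Equiv.Perm (Fin N)) : ∃ P : GL (Fin N) K, (P : Matrix (Fin N) (Fin N) K) = π.permMatrix K :=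
  ⟨Matrix.GeneralLinearGroup.mkOfDetNeZero _ (det_permMatrix_ne_zero π), rfl⟩

/-- The inverse of `P` is the matrix of `π⁻¹`. [cite: Serre1980Trees, II §1.1] -/
theorem coe_inv_eq_permMatrix_inv {π : Equiv.Perm (Fin N)} (P : GL (Fin N) K) (hP : (P : Matrix (Fin N) (Fin N) K) = π.permMatrix K) :
    ((P⁻¹ : GL (Fin N) K) : Matrix (Fin N) (Fin N) K) = (π⁻¹).permMatrix K := by
  rw [Matrix.coe_units_inv, hP]
  exact Matrix.inv_eq_left_inv (permMatrix_inv_mul π)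

/-- A ring endomorphism fixes a permutation matrix (entries `0`, `1`). [cite: Serre1980Trees, II §1.1] -/
theorem permMatrix_map (σ : K →+* K) (π : Equiv.Perm (Fin N)) : (π.permMatrix K).map σ = π.permMatrix K := by
  ext i j
  simp only [Matrix.map_apply, Equiv.Perm.permMatrix, PEquiv.toMatrix_apply, Equiv.toPEquiv_apply, Option.mem_def, Option.some.injEq]
  split_ifs <;> simp

/-- **CONJUGATING A DIAGONAL BY A PERMUTATION**: `π⁻¹.P · diag(d) · π.P = diag(d ∘ π⁻¹)`. [cite: Serre1980Trees, II §1.1] -/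
theorem permMatrix_inv_mul_diagonal_mul (π : Equiv.Perm (Fin N)) (d : Fin N → K) :
    (π⁻¹).permMatrix K * Matrix.diagonal d * π.permMatrix K = Matrix.diagonal (d ∘ ⇑π.symm) := by
  rw [Equiv.Perm.permMatrix, Equiv.Perm.permMatrix, PEquiv.toMatrix_toPEquiv_mul, PEquiv.mul_toMatrix_toPEquiv, Matrix.submatrix_submatrix,
    Equiv.Perm.inv_def, Function.id_comp, Function.comp_id]
  exact Matrix.submatrix_diagonal_equiv d π.symm

/-- `P⁻¹·T·P = diag(d ∘ π⁻¹)` for `T = diag(d)`, as `GL_N` elements' matrices. [cite: Serre1980Trees, II §1.1] -/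
theorem coe_conj_eq_diagonal {π : Equiv.Perm (Fin N)} (P : GL (Fin N) K) (hP : (P : Matrix (Fin N) (Fin N) K) = π.permMatrix K)
    (T : GL (Fin N) K) {d : Fin N → K} (hT : (T : Matrix (Fin N) (Fin N) K) = Matrix.diagonal d) :
    ((P⁻¹ * T * P : GL (Fin N) K) : Matrix (Fin N) (Fin N) K) = Matrix.diagonal (d ∘ ⇑π.symm) := by
  rw [Units.val_mul, Units.val_mul, coe_inv_eq_permMatrix_inv P hP, hT, hP]
  exact permMatrix_inv_mul_diagonal_mul π d

/-- `(σP)ᵀ·diag(D)·P = diag(D ∘ π⁻¹)`: the Gram matrix of a diagonal form in the permuted frame. [cite: Serre1980Trees, II §1.1] -/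
theorem formCongr_permMatrix_diagonal (σ : K →+* K) {π : Equiv.Perm (Fin N)} (P : GL (Fin N) K) (hP : (P : Matrix (Fin N) (Fin N) K) = π.permMatrix K)
    (D : Fin N → K) : formCongr σ P (Matrix.diagonal D) = Matrix.diagonal (D ∘ ⇑π.symm) := by
  rw [formCongr, hP, permMatrix_map, Matrix.transpose_permMatrix]
  exact permMatrix_inv_mul_diagonal_mul π D

/-- `(t·eᵢ) ∘ π⁻¹ = t·e_{π i}`. [cite: Serre1980Trees, II §1.1] -/
theorem single_comp_perm_inv (π : Equiv.Perm (Fin N)) (i : Fin N) (t : K) :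
    (Pi.single i t : Fin N → K) ∘ ⇑π.symm = Pi.single (π i) t := by
  ext j
  simp only [Function.comp_apply, Pi.single_apply, Equiv.symm_apply_eq]

section Valued

variable [Valued K ℤᵐ⁰]

/-- **MEMBERSHIP IN `P·M`**: `x ∈ P·M ↔ x ∘ π⁻¹ ∈ M` (`P⁻¹x = x ∘ π⁻¹`). [cite: Serre1980Trees, II §1.1] -/
theorem mem_mapGL_perm_iff {π : Equiv.Perm (Fin N)} (P : GL (Fin N) K) (hP : (P : Matrix (Fin N) (Fin N) K) = π.permMatrix K)
    (M : Submodule 𝒪[K] (Fin N → K)) (x : Fin N → K) : x ∈ mapGL P M ↔ x ∘ ⇑π.symm ∈ M := by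
  rw [mem_mapGL_iff, coe_inv_eq_permMatrix_inv P hP, Matrix.permMatrix_mulVec, Equiv.Perm.coe_inv]

/-! ## §2  Transport of the four stratum data: axis vector, normalisation, `𝓛₀`, dualisability; and of the weight -/

/-- **AXIS VECTORS**: `HasAxis ϖ (P·M) a ↔ HasAxis ϖ M (a ∘ π⁻¹)`. [cite: Serre1980Trees, II §1.1] -/
theorem hasAxis_mapGL_perm_iff {π : Equiv.Perm (Fin N)} (P : GL (Fin N) K) (hP : (P : Matrix (Fin N) (Fin N) K) = π.permMatrix K)
    (ϖ : K) (M : Submodule 𝒪[K] (Fin N → K)) (a : Fin N → ℕ) : HasAxis ϖ (mapGL P M) a ↔ HasAxis ϖ M (a ∘ ⇑π.symm) := by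
  rw [hasAxis_iff, hasAxis_iff]
  constructor
  · intro h j t
    have := h (π.symm j) t
    rwa [mem_mapGL_perm_iff P hP, single_comp_perm_inv, Equiv.apply_symm_apply] at this
  · intro h i t
    rw [mem_mapGL_perm_iff P hP, single_comp_perm_inv, h (π i) t, Function.comp_apply, Equiv.symm_apply_apply]

/-- **NORMALISATION**: `P·M` is normalised iff `M` is (the coordinate ideals are permuted). [cite: Serre1980Trees, II §1.1] -/
theorem isNormalisedLattice_mapGL_perm_iff {π : Equiv.Perm (Fin N)} (P : GL (Fin N) K) (hP : (P : Matrix (Fin N) (Fin N) K) = π.permMatrix K)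
    (M : Submodule 𝒪[K] (Fin N → K)) : IsNormalisedLattice (mapGL P M) ↔ IsNormalisedLattice M := by
  -- slot `i` of `P·M` is slot `π i` of `M`: `x ∈ P·M` iff `x = y ∘ π` with `y = x ∘ π⁻¹ ∈ M`
  have key : ∀ i, ((∀ x ∈ mapGL P M, Valued.v (x i) ≤ 1) ∧ ∃ x ∈ mapGL P M, Valued.v (x i) = 1) ↔
      ((∀ y ∈ M, Valued.v (y (π i)) ≤ 1) ∧ ∃ y ∈ M, Valued.v (y (π i)) = 1) := by
    intro i
    constructor
    · rintro ⟨h1, x, hx, hx1⟩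
      refine ⟨fun y hy => ?_, x ∘ ⇑π.symm, (mem_mapGL_perm_iff P hP M x).1 hx, by rwa [Function.comp_apply, Equiv.symm_apply_apply]⟩
      have h := h1 (y ∘ ⇑π) ((mem_mapGL_perm_iff P hP M _).2 (by rwa [Function.comp_assoc, Equiv.self_comp_symm, Function.comp_id]))
      exact h
    · rintro ⟨h1, y, hy, hy1⟩
      refine ⟨fun x hx => ?_, y ∘ ⇑π, (mem_mapGL_perm_iff P hP M _).2 (by rwa [Function.comp_assoc, Equiv.self_comp_symm, Function.comp_id]), hy1⟩
      have h := h1 (x ∘ ⇑π.symm) ((mem_mapGL_perm_iff P hP M x).1 hx)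
      rwa [Function.comp_apply, Equiv.symm_apply_apply] at h
  rw [IsNormalisedLattice, IsNormalisedLattice]
  constructor
  · intro h j
    have := (key (π.symm j)).1 (h (π.symm j))
    rwa [Equiv.apply_symm_apply] at this
  · intro h i
    exact (key i).2 (h (π i))

/-- **`𝓛₀`**: `P·M ∈ 𝓛₀(T) ↔ M ∈ 𝓛₀(P⁻¹TP)` (latt-ness, stability by ★ `mapGL_conj_mapGL_eq_iff`, normalisation by the previous lemma). [cite: Kottwitz1986BaseChangeUnits, §1 pp. 240–241] -/
theorem mapGL_perm_mem_normalisedStableLattices_iff {π : Equiv.Perm (Fin N)} (P : GL (Fin N) K) (hP : (P : Matrix (Fin N) (Fin N) K) = π.permMatrix K)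
    (T : GL (Fin N) K) (M : Submodule 𝒪[K] (Fin N → K)) :
    mapGL P M ∈ normalisedStableLattices T ↔ M ∈ normalisedStableLattices (P⁻¹ * T * P) := by
  rw [mem_normalisedStableLattices_iff, mem_normalisedStableLattices_iff, isNormalisedLattice_mapGL_perm_iff P hP]
  have hconj : mapGL T (mapGL P M) = mapGL P M ↔ mapGL (P⁻¹ * T * P) M = M := by
    rw [← mapGL_conj_mapGL_eq_iff P (P⁻¹ * T * P) M]
    rw [show P * (P⁻¹ * T * P) * P⁻¹ = T by group]
  have hlatt : (∃ g : GL (Fin N) K, mapGL P M = latt (g : Matrix (Fin N) (Fin N) K)) ↔ ∃ g : GL (Fin N) K, M = latt (g : Matrix (Fin N) (Fin N) K) := by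
    constructor
    · rintro ⟨g, hg⟩
      exact ⟨P⁻¹ * g, by rw [← mapGL_latt, ← hg, mapGL_inv_mapGL]⟩
    · rintro ⟨g, rfl⟩
      exact ⟨P * g, mapGL_latt P g⟩
  rw [hconj, hlatt]

/-- **DUALISABILITY**: `P·M` is dualisable iff `M` is (the dualising form `diag(D)` becomes `diag(D ∘ π⁻¹)`, ★ `isVertexLattice_formCongr_iff`). [cite: Rogawski1990, §4.9 Prop. 4.9.1 (a) p. 55] -/
theorem isDualisableLattice_mapGL_perm_iff (σ : K →+* K) (ϖ : K) {π : Equiv.Perm (Fin N)} (P : GL (Fin N) K)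
    (hP : (P : Matrix (Fin N) (Fin N) K) = π.permMatrix K) (M : Submodule 𝒪[K] (Fin N → K)) :
    IsDualisableLattice σ ϖ (mapGL P M) ↔ IsDualisableLattice σ ϖ M := by
  constructor
  · rintro ⟨D, hD, hV⟩
    refine ⟨D ∘ ⇑π.symm, fun i => hD (π.symm i), ?_⟩
    rw [← formCongr_permMatrix_diagonal σ P hP D]
    exact (isVertexLattice_formCongr_iff P (Matrix.diagonal D) 0 M).2 hV
  · rintro ⟨D, hD, hV⟩
    refine ⟨D ∘ ⇑π, fun i => hD (π i), ?_⟩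
    refine (isVertexLattice_formCongr_iff P (Matrix.diagonal (D ∘ ⇑π)) 0 M).1 ?_
    rw [formCongr_permMatrix_diagonal σ P hP]
    have e : (D ∘ ⇑π) ∘ ⇑π.symm = D := by rw [Function.comp_assoc, Equiv.self_comp_symm, Function.comp_id]
    rw [e]; exact hV

/-- **THE DIAGONAL STABILISER**: `u ∈ Stab(P·M) ↔ u ∘ π⁻¹ ∈ Stab(M)` (`P⁻¹·diag(u)·P = diag(u ∘ π⁻¹)`). [cite: Kottwitz1986BaseChangeUnits, §1 pp. 240–241] -/
theorem mem_latticeStabilizer_mapGL_perm_iff {π : Equiv.Perm (Fin N)} (P : GL (Fin N) K) (hP : (P : Matrix (Fin N) (Fin N) K) = π.permMatrix K)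
    (M : Submodule 𝒪[K] (Fin N → K)) (u : Fin N → Kˣ) :
    u ∈ latticeStabilizer (mapGL P M) ↔ (fun i => u (π.symm i)) ∈ latticeStabilizer M := by
  have e : P⁻¹ * diagGLUnits u * P = diagGLUnits (fun i => u (π.symm i)) := by
    refine Units.ext ?_
    rw [coe_conj_eq_diagonal P hP (diagGLUnits u) (coe_diagGLUnits u), coe_diagGLUnits]
    rfl
  rw [mem_latticeStabilizer_iff, mem_latticeStabilizer_iff, show diagGLUnits u = P * (P⁻¹ * diagGLUnits u * P) * P⁻¹ by group,
    mapGL_conj_mapGL_eq_iff, e]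

/-- **THE WEIGHT IS PERMUTATION-INVARIANT**: `stabiliserWeight σ (P·M) = stabiliserWeight σ M` — `S_F(P·M)` is the preimage of `S_F(M)` under the automorphism `u ↦ u ∘ π⁻¹`
of `(K^×)^N`, which maps `𝒰` onto itself (Mathlib `Subgroup.relIndex_comap`). [cite: Kottwitz1986BaseChangeUnits, §1 pp. 240–241] [cite: Rogawski1990, §4.9 Prop. 4.9.1 (a) p. 55] -/
theorem stabiliserWeight_mapGL_perm (σ : K →+* K) {π : Equiv.Perm (Fin N)} (P : GL (Fin N) K) (hP : (P : Matrix (Fin N) (Fin N) K) = π.permMatrix K)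
    (M : Submodule 𝒪[K] (Fin N → K)) : stabiliserWeight σ (mapGL P M) = stabiliserWeight σ M := by
  -- the re-indexing homomorphism `φ u = u ∘ π⁻¹`
  set φ : (Fin N → Kˣ) →* (Fin N → Kˣ) := MonoidHom.pi fun i => Pi.evalMonoidHom (fun _ : Fin N => Kˣ) (π.symm i) with hφ
  have hφ_apply : ∀ u i, φ u i = u (π.symm i) := fun u i => rfl
  have hsurj : ∀ w : Fin N → Kˣ, φ (fun i => w (π i)) = w := fun w => by
    funext i; rw [hφ_apply]; simp
  have hstab : latticeStabilizer (mapGL P M) = (latticeStabilizer M).comap φ := by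
    ext u; rw [Subgroup.mem_comap, mem_latticeStabilizer_mapGL_perm_iff P hP]; rfl
  have hU : (fixedUnitTorus σ N).map φ = fixedUnitTorus σ N := by
    ext w
    constructor
    · rintro ⟨u, hu, rfl⟩
      rw [SetLike.mem_coe, mem_fixedUnitTorus_iff] at hu
      exact (mem_fixedUnitTorus_iff σ _).2 ⟨fun i => hu.1 (π.symm i), fun i => hu.2 (π.symm i)⟩
    · intro hw
      rw [mem_fixedUnitTorus_iff] at hw
      exact ⟨fun i => w (π i), (mem_fixedUnitTorus_iff σ _).2 ⟨fun i => hw.1 (π i), fun i => hw.2 (π i)⟩, hsurj w⟩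
  have hidx : (fixedUnitStabilizer σ (mapGL P M)).relIndex (fixedUnitTorus σ N) = (fixedUnitStabilizer σ M).relIndex (fixedUnitTorus σ N) := by
    rw [fixedUnitStabilizer, fixedUnitStabilizer, Subgroup.inf_relIndex_right, Subgroup.inf_relIndex_right, hstab, Subgroup.relIndex_comap, hU]
  rw [stabiliserWeight, stabiliserWeight, hidx]

/-! ## §3  The heads: a stratum is the permuted image of the permuted stratum; the weighted counts agree; unit rescaling of `T` -/

/-- **`P · stratum(P⁻¹TP, a ∘ π⁻¹) = stratum(T, a)`.** [cite: Kottwitz1986BaseChangeUnits, §1 pp. 240–241] -/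
theorem image_mapGL_stratum (σ : K →+* K) (ϖ : K) {π : Equiv.Perm (Fin N)} (P : GL (Fin N) K) (hP : (P : Matrix (Fin N) (Fin N) K) = π.permMatrix K)
    (T : GL (Fin N) K) (a : Fin N → ℕ) :
    mapGL P '' stratum σ ϖ (P⁻¹ * T * P) (a ∘ ⇑π.symm) = stratum σ ϖ T a := by
  ext M'
  constructor
  · rintro ⟨M, hM, rfl⟩
    rw [mem_stratum_iff] at hM ⊢
    exact ⟨(mapGL_perm_mem_normalisedStableLattices_iff P hP T M).2 hM.1, (isDualisableLattice_mapGL_perm_iff σ ϖ P hP M).2 hM.2.1,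
      (hasAxis_mapGL_perm_iff P hP ϖ M a).2 hM.2.2⟩
  · intro hM'
    refine ⟨mapGL P⁻¹ M', ?_, mapGL_mapGL_inv P M'⟩
    rw [mem_stratum_iff] at hM' ⊢
    have h := hM'
    rw [← mapGL_mapGL_inv P M'] at h
    exact ⟨(mapGL_perm_mem_normalisedStableLattices_iff P hP T _).1 h.1, (isDualisableLattice_mapGL_perm_iff σ ϖ P hP _).1 h.2.1,
      (hasAxis_mapGL_perm_iff P hP ϖ _ a).1 h.2.2⟩

/-- **§P HEAD — THE WEIGHTED COUNT OF A STRATUM IS INVARIANT UNDER A COORDINATE PERMUTATION**: for `P` the matrix of `π`,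
`∑ᶠ_{M ∈ stratum(T, a)} 1∕[𝒰 : S_F(M)] = ∑ᶠ_{M ∈ stratum(P⁻¹TP, a ∘ π⁻¹)} 1∕[𝒰 : S_F(M)]` (for `T = diag(d)`: `P⁻¹TP = diag(d ∘ π⁻¹)`, `coe_conj_eq_diagonal`).
[cite: Kottwitz1986BaseChangeUnits, §1 pp. 240–241] [cite: Rogawski1990, §4.9 Prop. 4.9.1 (a) p. 55] -/
theorem finsum_stabiliserWeight_stratum_perm (σ : K →+* K) (ϖ : K) {π : Equiv.Perm (Fin N)} (P : GL (Fin N) K)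
    (hP : (P : Matrix (Fin N) (Fin N) K) = π.permMatrix K) (T : GL (Fin N) K) (a : Fin N → ℕ) :
    ∑ᶠ M ∈ stratum σ ϖ T a, stabiliserWeight σ M = ∑ᶠ M ∈ stratum σ ϖ (P⁻¹ * T * P) (a ∘ ⇑π.symm), stabiliserWeight σ M := by
  rw [← image_mapGL_stratum σ ϖ P hP T a, finsum_mem_image (mapGL_injective P).injOn]
  exact finsum_mem_congr rfl fun M _ => stabiliserWeight_mapGL_perm σ P hP M

/-- **UNIT RESCALING OF THE TORUS ELEMENT**: `𝓛₀(T″) = 𝓛₀(T)` when `T″ = s·T` with `|s| = 1` (★ `mapGL_eq_of_coe_eq_smul`: a unit homothety fixes every `𝒪`-submodule).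
[cite: Kottwitz1986BaseChangeUnits, §1 pp. 240–241] -/
theorem normalisedStableLattices_eq_of_coe_eq_smul {s : K} (hs : Valued.v s = 1) {T T'' : GL (Fin N) K}
    (hTT : (T'' : Matrix (Fin N) (Fin N) K) = s • (T : Matrix (Fin N) (Fin N) K)) : normalisedStableLattices T'' = normalisedStableLattices T := by
  ext M
  rw [mem_normalisedStableLattices_iff, mem_normalisedStableLattices_iff, mapGL_eq_of_coe_eq_smul hs hTT M]

/-- Hence `stratum(sT, a) = stratum(T, a)` for a unit scalar `s`. [cite: Kottwitz1986BaseChangeUnits, §1 pp. 240–241] -/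
theorem stratum_eq_of_coe_eq_smul (σ : K →+* K) (ϖ : K) {s : K} (hs : Valued.v s = 1) {T T'' : GL (Fin N) K}
    (hTT : (T'' : Matrix (Fin N) (Fin N) K) = s • (T : Matrix (Fin N) (Fin N) K)) (a : Fin N → ℕ) : stratum σ ϖ T'' a = stratum σ ϖ T a := by
  ext M
  rw [mem_stratum_iff, mem_stratum_iff, normalisedStableLattices_eq_of_coe_eq_smul hs hTT]

end Valued

/-! ## §4  The B10 sockets `stub_P_G2`, `stub_P_G3`: the glued strata with foot on `B₂`, `B₃` from the `B₁`-footed count (taken as a hypothesis `hG1` = ★-to-be `stub_B56_G1`) -/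

section Sockets

open Literature.NumberTheory.Automorphic.UnitaryThreeFourFrame

variable {K : Type} [Field K] [Valued K ℤᵐ⁰] {σ : K →+* K} {ϖ : K} {α β : K} {N₀ n₁ n₂ n₃ : ℕ} {T : GL (Fin 3) K}

/-- The element datum is symmetric in `(α, β)` with the depths `(n₁, n₂)` swapped. [cite: Rogawski1990, §4.9 Prop. 4.9.1 (a) p. 55] -/
theorem isElementDatum_swap (hE : IsElementDatum σ ϖ N₀ α β n₁ n₂ n₃) : IsElementDatum σ ϖ N₀ β α n₂ n₁ n₃ := by
  obtain ⟨hα, hβ, hαβ, hα1, hβ1, h₁, h₂, h₃, hN₁, hN₂, hN₃⟩ := hE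
  exact ⟨hβ, hα, hαβ.symm, hβ1, hα1, h₂, h₁, by rw [Valuation.map_sub_swap, h₃], hN₂, hN₁, hN₃⟩

/-- The element datum of the RESCALED pair `(α⁻¹, βα⁻¹)` (the torus element `diag(1, β, α)` brought back to the shape `diag(·, ·, 1)` by the unit scalar `α⁻¹`): depths
`(n₃, n₂, n₁)`. [cite: Rogawski1990, §4.9 Prop. 4.9.1 (a) p. 55] -/
theorem isElementDatum_rescale (hvσ : ∀ a, Valued.v (σ a) = Valued.v a) (hE : IsElementDatum σ ϖ N₀ α β n₁ n₂ n₃) :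
    IsElementDatum σ ϖ N₀ α⁻¹ (β * α⁻¹) n₃ n₂ n₁ := by
  obtain ⟨hα, hβ, hαβ, hα1, hβ1, h₁, h₂, h₃, hN₁, hN₂, hN₃⟩ := hE
  have hα0 : α ≠ 0 := fun h => by rw [h, zero_mul] at hα; exact zero_ne_one hα
  have hvα : Valued.v α = 1 := by
    have h : Valued.v α * Valued.v α = 1 := by nth_rw 2 [← hvσ α]; rw [← map_mul, hα, map_one]
    rw [← pow_two] at h
    exact ((pow_eq_one_iff).1 h).resolve_right two_ne_zero
  have hvαi : Valued.v α⁻¹ = 1 := by rw [map_inv₀, hvα, inv_one]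
  refine ⟨?_, ?_, ?_, ?_, ?_, ?_, ?_, ?_, hN₃, hN₂, hN₁⟩
  · rw [map_inv₀, ← mul_inv, hα, inv_one]
  · rw [map_mul, map_inv₀, mul_mul_mul_comm, hβ, ← mul_inv, hα, inv_one, mul_one]
  · intro h; exact hβ1 (mul_right_cancel₀ (inv_ne_zero hα0) ((one_mul α⁻¹).trans h)).symm
  · intro h; exact hα1 (inv_eq_one.1 h)
  · intro h; exact hαβ ((mul_inv_eq_one₀ hα0).1 h).symm
  · rw [show β * α⁻¹ - 1 = (β - α) * α⁻¹ by field_simp, map_mul, hvαi, mul_one, Valuation.map_sub_swap, h₃]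
  · rw [show α⁻¹ - 1 = (1 - α) * α⁻¹ by field_simp, map_mul, hvαi, mul_one, Valuation.map_sub_swap, h₂]
  · rw [show α⁻¹ - β * α⁻¹ = (1 - β) * α⁻¹ by field_simp, map_mul, hvαi, mul_one, Valuation.map_sub_swap, h₁]

/-- **SOCKET `stub_P_G2` — FOOT ON `B₂`, axis `(2ρ+s, 2ρ, 2ρ+s)`**, from the `B₁`-footed count `hG1` (the ★-to-be `stub_B56_G1`, quantified over the element datum) by the
coordinate swap `(0 1)`: `diag(α, β, 1) ↦ diag(β, α, 1)`, depths `(n₁, n₂, n₃) ↦ (n₂, n₁, n₃)`. [cite: Kottwitz1986BaseChangeUnits, §1 pp. 240–241] [cite: Rogawski1990, §4.9 Prop. 4.9.1 (a) p. 55] -/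
theorem finsum_stabiliserWeight_stratum_G2_of_G1 (hE : IsElementDatum σ ϖ N₀ α β n₁ n₂ n₃)
    (hT : (T : Matrix (Fin 3) (Fin 3) K) = Matrix.diagonal ![α, β, 1]) (ρ s : ℕ) (F : ℕ → ℕ → ℕ → ℚ)
    (hG1 : ∀ {α' β' : K} {n₁' n₂' n₃' : ℕ} (T' : GL (Fin 3) K), IsElementDatum σ ϖ N₀ α' β' n₁' n₂' n₃' →
      (T' : Matrix (Fin 3) (Fin 3) K) = Matrix.diagonal ![α', β', 1] →
        ∑ᶠ M ∈ stratum σ ϖ T' ![2 * ρ, 2 * ρ + s, 2 * ρ + s], stabiliserWeight σ M = F n₁' n₂' n₃') :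
    ∑ᶠ M ∈ stratum σ ϖ T ![2 * ρ + s, 2 * ρ, 2 * ρ + s], stabiliserWeight σ M = F n₂ n₁ n₃ := by
  obtain ⟨P, hP⟩ := exists_gl_coe_eq_permMatrix (K := K) (Equiv.swap (0 : Fin 3) 1)
  rw [finsum_stabiliserWeight_stratum_perm σ ϖ P hP T]
  have ha : (![2 * ρ + s, 2 * ρ, 2 * ρ + s] : Fin 3 → ℕ) ∘ ⇑(Equiv.swap (0 : Fin 3) 1).symm = ![2 * ρ, 2 * ρ + s, 2 * ρ + s] := by
    ext i; fin_cases i <;> rfl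
  have hd : (![α, β, 1] : Fin 3 → K) ∘ ⇑(Equiv.swap (0 : Fin 3) 1).symm = ![β, α, 1] := by
    ext i; fin_cases i <;> rfl
  rw [ha]
  exact hG1 _ (isElementDatum_swap hE) (by rw [coe_conj_eq_diagonal P hP T hT, hd])

/-- **SOCKET `stub_P_G3` — FOOT ON `B₃`, axis `(2ρ+s, 2ρ+s, 2ρ)`**, from `hG1` by the coordinate swap `(0 2)` and the unit rescaling by `α⁻¹`:
`diag(α, β, 1) ↦ diag(1, β, α) ∼ diag(α⁻¹, βα⁻¹, 1)`, depths `(n₁, n₂, n₃) ↦ (n₃, n₂, n₁)`. [cite: Kottwitz1986BaseChangeUnits, §1 pp. 240–241] [cite: Rogawski1990, §4.9 Prop. 4.9.1 (a) p. 55] -/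
theorem finsum_stabiliserWeight_stratum_G3_of_G1 (hvσ : ∀ a, Valued.v (σ a) = Valued.v a) (hE : IsElementDatum σ ϖ N₀ α β n₁ n₂ n₃)
    (hT : (T : Matrix (Fin 3) (Fin 3) K) = Matrix.diagonal ![α, β, 1]) (ρ s : ℕ) (F : ℕ → ℕ → ℕ → ℚ)
    (hG1 : ∀ {α' β' : K} {n₁' n₂' n₃' : ℕ} (T' : GL (Fin 3) K), IsElementDatum σ ϖ N₀ α' β' n₁' n₂' n₃' →
      (T' : Matrix (Fin 3) (Fin 3) K) = Matrix.diagonal ![α', β', 1] →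
        ∑ᶠ M ∈ stratum σ ϖ T' ![2 * ρ, 2 * ρ + s, 2 * ρ + s], stabiliserWeight σ M = F n₁' n₂' n₃') :
    ∑ᶠ M ∈ stratum σ ϖ T ![2 * ρ + s, 2 * ρ + s, 2 * ρ], stabiliserWeight σ M = F n₃ n₂ n₁ := by
  have hα : α * σ α = 1 := hE.1
  have hα0 : α ≠ 0 := fun h => by rw [h, zero_mul] at hα; exact zero_ne_one hα
  have hvα : Valued.v α = 1 := by
    have h : Valued.v α * Valued.v α = 1 := by nth_rw 2 [← hvσ α]; rw [← map_mul, hα, map_one]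
    rw [← pow_two] at h
    exact ((pow_eq_one_iff).1 h).resolve_right two_ne_zero
  obtain ⟨P, hP⟩ := exists_gl_coe_eq_permMatrix (K := K) (Equiv.swap (0 : Fin 3) 2)
  rw [finsum_stabiliserWeight_stratum_perm σ ϖ P hP T]
  have ha : (![2 * ρ + s, 2 * ρ + s, 2 * ρ] : Fin 3 → ℕ) ∘ ⇑(Equiv.swap (0 : Fin 3) 2).symm = ![2 * ρ, 2 * ρ + s, 2 * ρ + s] := by
    ext i; fin_cases i <;> rfl
  have hd : (![α, β, 1] : Fin 3 → K) ∘ ⇑(Equiv.swap (0 : Fin 3) 2).symm = ![1, β, α] := by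
    ext i; fin_cases i <;> rfl
  rw [ha]
  -- rescale `diag(1, β, α)` by the unit `α⁻¹`
  have hdet : (Matrix.diagonal ![α⁻¹, β * α⁻¹, 1] : Matrix (Fin 3) (Fin 3) K).det ≠ 0 := by
    rw [Matrix.det_diagonal, Fin.prod_univ_three]
    have hβ0 : β ≠ 0 := fun h => by have := hE.2.1; rw [h, zero_mul] at this; exact zero_ne_one this
    simp [hα0, hβ0]
  have hconj := coe_conj_eq_diagonal P hP T hT
  rw [hd] at hconj
  have hTT : ((Matrix.GeneralLinearGroup.mkOfDetNeZero _ hdet : GL (Fin 3) K) : Matrix (Fin 3) (Fin 3) K) =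
      α⁻¹ • ((P⁻¹ * T * P : GL (Fin 3) K) : Matrix (Fin 3) (Fin 3) K) := by
    rw [hconj, ← Matrix.diagonal_smul]
    show Matrix.diagonal ![α⁻¹, β * α⁻¹, 1] = _
    congr 1
    ext i; fin_cases i
    · simp
    · simp [mul_comm]
    · simp [inv_mul_cancel₀ hα0]
  rw [← stratum_eq_of_coe_eq_smul σ ϖ (by rw [map_inv₀, hvα, inv_one]) hTT]
  exact hG1 _ (isElementDatum_rescale hvσ hE) rfl

end Sockets

end Summit.HodgeConjecture.HodgeConjecture.Cruxes.H413.F0P3cDyRamDiagonalPermutation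

end
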